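import Summits.BirchSwinnertonDyer.BirchSwinnertonDyer.Theses.DefiniteGrossPeriodAtTwo

/-!
# Route `DefiniteGrossPeriodAtTwo`: glue of the parity split of crux C1 `GrossPeriodExactnessAtTwo` (LINE 7)

Item stmt-BirchSwinnertonDyer-26985 (`GrossPeriodExactnessAtTwoGlue`, glue of the gen-2 split of crux
stmt-BirchSwinnertonDyer-23664 `GrossPeriodExactnessAtTwo` into C1u stmt-26983 `GrossPeriodUnitRigidityAtTwo`
(odd Gross period ⇒ trivial 2-primary Selmer group) and C1e stmt-26984 `GrossPeriodExactnessAtTwoEven` (even, non-zero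
Gross period ⇒ the exact formula)). THEOREM-ONLY file (no definition, no named fact, no `sorry`).

The glue is pure logic: the Gross period `L` is an integer; if it is odd, C1u gives `#Sel_{2^∞}(E/K) = 1 = 2^(2·0)` and
`v₂(L) = 0`; if it is not odd it is even, i.e. `2 ∣ L`, and C1e gives the formula verbatim. BSD is not proved by any
of this; the parent crux C1 is not proved by this file either (it closes the GLUE item only: children ⟹ parent).
-/

set_option autoImplicit false
set_option linter.dupNamespace false

namespace Summit.BirchSwinnertonDyer.BirchSwinnertonDyer.Theorems.DefiniteGrossGlue

open Summit.BirchSwinnertonDyer.BirchSwinnertonDyer.Theses.DefiniteGrossPeriodAtTwo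

/-- **Glue of the LINE-7 parity split of `GrossPeriodExactnessAtTwo`** (item stmt-BirchSwinnertonDyer-26985, by name):
`GrossPeriodUnitRigidityAtTwo → GrossPeriodExactnessAtTwoEven → GrossPeriodExactnessAtTwo`.
Proof: case on the parity of the (integer) Gross period. [folklore] -/
theorem grossPeriodExactnessAtTwoGlue_proof : GrossPeriodExactnessAtTwoGlue := by
  intro hU hE W _ _ Nplus Nminus a b O K _ _ ψ I φ rep RI IsEig hcm hH hK D hne
  by_cases hodd : Odd (Literature.NumberTheory.EllipticCurves.BertoliniLongoVenerucci2026.grossPeriod K ψ I φ rep)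
  · have h1 := hU W Nplus Nminus a b O K ψ I φ rep RI IsEig hcm hH hK D hodd
    have hv : padicValInt 2
        (Literature.NumberTheory.EllipticCurves.BertoliniLongoVenerucci2026.grossPeriod K ψ I φ rep) = 0 := by
      apply padicValInt.eq_zero_of_not_dvd
      intro h2
      exact (Int.not_even_iff_odd.mpr hodd) (even_iff_two_dvd.mpr (by exact_mod_cast h2))
    rw [h1, hv]; norm_num
  · have h2 : (2 : ℤ) ∣ Literature.NumberTheory.EllipticCurves.BertoliniLongoVenerucci2026.grossPeriod K ψ I φ rep :=
      even_iff_two_dvd.mp (Int.not_odd_iff_even.mp hodd)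
    exact hE W Nplus Nminus a b O K ψ I φ rep RI IsEig hcm hH hK D hne h2

end Summit.BirchSwinnertonDyer.BirchSwinnertonDyer.Theorems.DefiniteGrossGlue
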